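import Summits.BirchSwinnertonDyer.Rank1Residual.X4.OldPairOfNewVanishing
import Literature.NumberTheory.EllipticCurves.NewformsStrongMultiplicityOne
import HarnessLib

/-!
# The `ℓ`-old decomposition from the vanishing on the `ℓ`-new cycles when `ℓ` DIVIDES `M` (additive defect primes): extension across the THREE-level cokernel (cell `b2b-bsdres`, seat additive-p4, line V47 brick)

HONEST FRAMING (verbatim, cell `b2b-bsdres`): the goal of the cell is to DELETE the COMBINATION-SHAPED
residual classes for ALL analytic-rank `≤ 1` curves over `ℚ` — "full BSD formula for every rank `≤ 1`
curve in class `C`" assembled STRICTLY from published theorems — so that the rank-`≤ 1` remainder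
becomes exactly the CONSTRUCTION-SHAPED classes, which are TYPED (missing-input Props), NOT attempted;
this is not "finishing BSD". This file: TOOL theorems, 0 defs, 0 facts, nothing booked; X4
CONSTRUCTION-SHAPED. It prepares the NL residue (TAM-DEFECT₂ rows whose defect prime `ℓ` is ADDITIVE,
`ℓ² ∣ N`): the V46 kernel theorem `exists_oldPair_of_apply_eq_zero_of_ribet1984_iharaLemma` with the
two-copy Ihara lemma (which needs `ℓ ∤ M`) replaced by an EXPLICIT three-level hypothesis.

## What is proved

* `exists_additive_extension_of_ker` (generic): `L` a subgroup of an abelian group `V`, finitely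
  generated as a `ℤ`-module, `T : V →+ W` with `W` a vector space over a field of characteristic `0`, `g`
  a function additive on `{x ∈ L : T x = 0}` ⟹ some `G` additive on `L` agrees with `g` there. (The image
  `T(L)` is finitely generated and torsion-free, hence FREE; a section on a basis gives a projector
  `P = id − σ∘T` of `L` onto the kernel; `G := g ∘ P`.)
* `dualMap_degeneracyMap0_comm`: `β′_* ∘ α_* = α′_* ∘ β_*` on `S₂(Γ₀(Mℓ))^∨` for the degeneracy maps
  `M′ →(α′=1, β′=ℓ) M →(α=1, β=ℓ) Mℓ` with `M′ℓ ∣ M` (both are push-forward along `τ ↦ ℓτ`;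
  `degeneracyMap0_comp`). Hence `im(α_*, β_*) ⊆ K := {(x, y) : β′_* x = α′_* y}`.
* **`exists_oldPair_of_apply_eq_zero_of_iharaThree`**: as the V46 theorem, for ANY prime `ℓ` (no
  `ℓ ∤ M`): `Φ : S₂(Γ₀(Mℓ))^∨ → 𝔽_p` additive and `T_r`-eigen on `H₁(X₀(Mℓ), ℤ)` (`r ∤ Mℓ`), vanishing
  on `ker α_* ∩ ker β_*`, one numeral prime `q₀ ≡ 1 (mod Mℓ)` with `θ(q₀) ≢ q₀ + 1`, AND the
  three-level Ihara statement AS A HYPOTHESIS — for every odd non-Eisenstein maximal `𝔫` of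
  `𝕋̃ = ℤ[T_r : r ∤ Mℓ]` (level `M`) some `s ∉ 𝔫` carries `K ∩ H₁(X₀(M), ℤ)²` into `im(α_*, β_*)`
  (the middle exactness of `H₁(X₀(M′ℓ²)) → H₁(X₀(M′ℓ))² → H₁(X₀(M′))` after localisation; printed
  for `Γ₁(M′) ∩ Γ₀(ℓ^k)` in Darmon–Diamond–Taylor §4.5 p. 137) ⟹ `Φ = Λ₁∘α_* + Λ₂∘β_*` on
  `H₁(X₀(Mℓ), ℤ)` with `Λ₁, Λ₂` ADDITIVE on `H₁(X₀(M), ℤ)`. (Branch `1 ∈ 𝔫₀` as in V46; in the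
  character branch `g(x, y) := χ(s)⁻¹ Φ(z(s x, s y))` is additive on `K ∩ H₁²` by fibre constancy and
  is extended to `H₁(X₀(M), ℤ)²` by `exists_additive_extension_of_ker`.)

## References

* H. Darmon, F. Diamond, R. Taylor, *Fermat's Last Theorem* (1995), §4.5 p. 137 (three-level
  Ihara), Lemma 4.28, Lemma 4.30. [cite: DarmonDiamondTaylor1995, Lemma 4.28 (a), Lemma 4.30 (b), §4.5 pp. 135–137]
* F. Diamond, J. Shurman, *A first course in modular forms* (2005), §5.6 Exercise 5.6.2, Prop. 5.6.2. [cite: DiamondShurman2005, §5.6 Exercise 5.6.2]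
-/

noncomputable section

open scoped MatrixGroups ModularForm

open CongruenceSubgroup Finset Matrix Module

open Literature.NumberTheory.EllipticCurves Literature.NumberTheory.EllipticCurves.ModularForms
  Literature.NumberTheory.EllipticCurves.ModularForms.HidaCohomology

namespace Summit.BirchSwinnertonDyer.Rank1Residual.LevelLowering

/-! ### §1 Additive extension across the kernel of a map to a torsion-free group -/

section Extension

/-- **Additive extension from a kernel.** `L ≤ V` finitely generated (as a `ℤ`-module), `T : V →+ W`
with `W` a vector space over a field of characteristic zero, `g : V → k` additive on
`{x ∈ L : T x = 0}`: there is `G : V → k` additive on `L` with `G = g` on `{x ∈ L : T x = 0}`. The image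
`T(L)` is finitely generated and torsion-free, hence free; a section `σ` on a basis gives the projector
`P = id − σ ∘ T` of `L` onto the kernel, and `G := g ∘ P`. [folklore] -/
theorem exists_additive_extension_of_ker {K V W k : Type*} [Field K] [CharZero K] [AddCommGroup V]
    [AddCommGroup W] [Module K W] [AddCommGroup k] (L : AddSubgroup V) [Module.Finite ℤ L]
    (T : V →+ W) (g : V → k)
    (hg : ∀ x ∈ L, ∀ y ∈ L, T x = 0 → T y = 0 → g (x + y) = g x + g y) :
    ∃ G : V → k, (∀ x ∈ L, ∀ y ∈ L, G (x + y) = G x + G y) ∧ ∀ x ∈ L, T x = 0 → G x = g x := by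
  classical
  let T' : L →ₗ[ℤ] W := (T.toIntLinearMap).comp L.toIntSubmodule.subtype
  haveI : IsAddTorsionFree W := by
    refine ⟨fun n hn a b hab => ?_⟩
    · have h : (n : K) • a = (n : K) • b := by
        simpa [Nat.cast_smul_eq_nsmul] using hab
      exact smul_right_injective W (by exact_mod_cast hn : (n : K) ≠ 0) h
  let R := LinearMap.range T'
  haveI : Module.Finite ℤ R := inferInstance
  haveI : Module.Free ℤ R := Module.free_of_finite_type_torsion_free'
  let b := Module.Free.chooseBasis ℤ R
  have hpre : ∀ i, ∃ m : L, T' m = (b i : W) := fun i ↦ by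
    obtain ⟨m, hm⟩ := (b i).2
    exact ⟨m, hm⟩
  choose m hm using hpre
  let σ : R →ₗ[ℤ] L := b.constr ℤ m
  have hσ : ∀ r : R, (T' (σ r) : W) = r := by
    intro r
    have key : (T'.rangeRestrict).comp σ = LinearMap.id := by
      refine b.ext fun i ↦ ?_
      apply Subtype.ext
      simp only [LinearMap.comp_apply, LinearMap.id_apply, σ, Basis.constr_basis, LinearMap.codRestrict_apply,
        LinearMap.rangeRestrict, hm]
    have := congrArg (fun f ↦ (f r : W)) key
    simpa using this
  let P : L →ₗ[ℤ] L := LinearMap.id - σ.comp T'.rangeRestrict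
  have hPker : ∀ x : L, T (P x : V) = 0 := by
    intro x
    have e1 : T (P x : V) = T' (P x) := rfl
    rw [e1]
    simp only [P, LinearMap.sub_apply, LinearMap.id_apply, LinearMap.comp_apply, map_sub]
    rw [hσ]
    simp [LinearMap.rangeRestrict, sub_self]
  have hPid : ∀ x : L, T (x : V) = 0 → P x = x := by
    intro x hx
    have hT' : T' x = 0 := hx
    have hr : T'.rangeRestrict x = 0 := by
      apply Subtype.ext
      simpa [LinearMap.rangeRestrict] using hT'
    simp [P, hr]
  refine ⟨fun v ↦ if hv : v ∈ L then g (P ⟨v, hv⟩ : V) else 0, ?_, ?_⟩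
  · intro x hx y hy
    have hxy : x + y ∈ L := add_mem hx hy
    simp only [dif_pos hx, dif_pos hy, dif_pos hxy]
    have e : (⟨x + y, hxy⟩ : L) = ⟨x, hx⟩ + ⟨y, hy⟩ := rfl
    rw [e, map_add]
    exact hg _ (P ⟨x, hx⟩).2 _ (P ⟨y, hy⟩).2 (hPker _) (hPker _)
  · intro x hx hTx
    simp only [dif_pos hx]
    rw [hPid ⟨x, hx⟩ hTx]

end Extension

/-! ### §2 The two push-forwards to level `M′` commute: `im(α_*, β_*) ⊆ K` -/

section Commute

variable {M' M : ℕ} [NeZero M'] [NeZero M] {ℓ : ℕ} [Fact ℓ.Prime]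

/-- Degeneracy maps with equal parameters are equal (the `NeZero` instance is a proposition).
[folklore] -/
theorem degeneracyMap0_congr {L N d₁ d₂ : ℕ} [NeZero L] [NeZero N] [NeZero d₁] [NeZero d₂]
    (h : d₁ = d₂) : degeneracyMap0 L N d₁ 2 = degeneracyMap0 L N d₂ 2 := by
  subst h
  rfl

/-- **`β′_* ∘ α_* = α′_* ∘ β_*`** on `S₂(Γ₀(Mℓ))^∨`, for `M′ℓ ∣ M` and the degeneracy maps
`α′ = [1], β′ = [ℓ] : S₂(Γ₀(M′)) → S₂(Γ₀(M))`, `α = [1], β = [ℓ] : S₂(Γ₀(M)) → S₂(Γ₀(Mℓ))`: both sides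
are the push-forward along `τ ↦ ℓτ` (`degeneracyMap0_comp`, Diamond–Shurman Ex. 5.6.2).
[cite: DiamondShurman2005, §5.6 Exercise 5.6.2] -/
theorem dualMap_degeneracyMap0_comm (hM' : M' * ℓ ∣ M)
    (z : Module.Dual ℂ (CuspForm (Gamma0 (M * ℓ)) 2)) :
    (degeneracyMap0 M' M ℓ 2).dualMap ((degeneracyMap0 M (M * ℓ) 1 2).dualMap z) =
      (degeneracyMap0 M' M 1 2).dualMap ((degeneracyMap0 M (M * ℓ) ℓ 2).dualMap z) := by
  have hℓ : ℓ.Prime := Fact.out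
  haveI : NeZero ℓ := ⟨hℓ.ne_zero⟩
  have h1 : M' * 1 ∣ M := by rw [mul_one]; exact (dvd_mul_right M' ℓ).trans hM'
  have h1d : M * 1 ∣ M * ℓ := by rw [mul_one]; exact dvd_mul_right M ℓ
  have hℓd : M * ℓ ∣ M * ℓ := dvd_rfl
  ext g
  simp only [LinearMap.dualMap_apply]
  rw [degeneracyMap0_degeneracyMap0 M' M (M * ℓ) ℓ 1 2 hM' h1d g,
    degeneracyMap0_degeneracyMap0 M' M (M * ℓ) 1 ℓ 2 h1 hℓd g, degeneracyMap0_congr (mul_comm ℓ 1)]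

end Commute

/-! ### §3 (NV) ⟹ (OLD) for any prime `ℓ`, from a three-level Ihara hypothesis -/

section IharaThree

variable {M' M : ℕ} [NeZero M'] [NeZero M] {ℓ : ℕ} [Fact ℓ.Prime] {p : ℕ} [hp : Fact p.Prime]

/-- **THE `ℓ`-OLD DECOMPOSITION FROM THE VANISHING ON THE `ℓ`-NEW CYCLES, `ℓ ∣ M` ALLOWED** (three-level
Ihara as a HYPOTHESIS). `M′ℓ ∣ M`, `p` odd, `θ` integer eigenvalues, `Φ : S₂(Γ₀(Mℓ))^∨ → 𝔽_p` additive
and `T_r`-eigen (`r ∤ Mℓ`) on `H₁(X₀(Mℓ), ℤ)`, vanishing on `ker α_* ∩ ker β_* ∩ H₁`; `q₀ ≡ 1 (mod Mℓ)`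
prime with `θ(q₀) ≢ q₀ + 1`; `hI3`: for every maximal `𝔫 ⊂ 𝕋̃` with `2 ∉ 𝔫`, not Eisenstein, some
`s ∉ 𝔫` and, for all cycles `x, y ∈ H₁(X₀(M), ℤ)` with `β′_* x = α′_* y`, a cycle `z ∈ H₁(X₀(Mℓ), ℤ)`
with `α_* z = s • x`, `β_* z = s • y`. Then `Φ = Λ₁∘α_* + Λ₂∘β_*` on `H₁(X₀(Mℓ), ℤ)` for some
`Λ₁, Λ₂` additive on `H₁(X₀(M), ℤ)`. For `ℓ ∤ M` the hypothesis is implied by `ribet1984_iharaLemma`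
(take any `y`); for `ℓ ∣ M` it is the three-level statement of Darmon–Diamond–Taylor §4.5.
[cite: DarmonDiamondTaylor1995, Lemma 4.28 (a), Lemma 4.30 (b), §4.5 pp. 135–137] -/
theorem exists_oldPair_of_apply_eq_zero_of_iharaThree (hM' : M' * ℓ ∣ M) (hp2 : p ≠ 2) (θ : ℕ → ℤ)
    (Φ : Module.Dual ℂ (CuspForm (Gamma0 (M * ℓ)) 2) → ZMod p)
    (haddΦ : ∀ x ∈ periodHomology (M * ℓ), ∀ y ∈ periodHomology (M * ℓ), Φ (x + y) = Φ x + Φ y)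
    (hΦT : ∀ (r : ℕ) (hr : r.Prime), ¬ r ∣ M * ℓ → ∀ z ∈ periodHomology (M * ℓ),
      Φ (HeckeRing0.T (M * ℓ) 2 r hr • z) = ((θ r : ℤ) : ZMod p) * Φ z)
    (hvan : ∀ z ∈ periodHomology (M * ℓ), (degeneracyMap0 M (M * ℓ) 1 2).dualMap z = 0 →
      (degeneracyMap0 M (M * ℓ) ℓ 2).dualMap z = 0 → Φ z = 0)
    {q₀ : ℕ} (hq₀ : q₀.Prime) (hq₀1 : q₀ ≡ 1 [MOD M * ℓ])
    (hθq₀ : ((θ q₀ : ℤ) : ZMod p) ≠ q₀ + 1)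
    (hI3 : ∀ 𝔫 : Ideal (HeckeRing0.primeTo M 2 (M * ℓ)), 𝔫.IsMaximal →
      (2 : HeckeRing0.primeTo M 2 (M * ℓ)) ∉ 𝔫 → ¬ HeckeRing0.primeTo.IsEisenstein 𝔫 →
      ∃ s : HeckeRing0.primeTo M 2 (M * ℓ), s ∉ 𝔫 ∧
        ∀ x ∈ periodHomology M, ∀ y ∈ periodHomology M,
          (degeneracyMap0 M' M ℓ 2).dualMap x = (degeneracyMap0 M' M 1 2).dualMap y →
          ∃ z ∈ periodHomology (M * ℓ),
            (degeneracyMap0 M (M * ℓ) 1 2).dualMap z = (s : HeckeRing0 M 2) • x ∧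
            (degeneracyMap0 M (M * ℓ) ℓ 2).dualMap z = (s : HeckeRing0 M 2) • y) :
    ∃ Λ₁ Λ₂ : Module.Dual ℂ (CuspForm (Gamma0 M) 2) → ZMod p,
      (∀ x ∈ periodHomology M, ∀ y ∈ periodHomology M, Λ₁ (x + y) = Λ₁ x + Λ₁ y) ∧
      (∀ x ∈ periodHomology M, ∀ y ∈ periodHomology M, Λ₂ (x + y) = Λ₂ x + Λ₂ y) ∧
      ∀ z ∈ periodHomology (M * ℓ),
        Φ z = Λ₁ ((degeneracyMap0 M (M * ℓ) 1 2).dualMap z) +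
          Λ₂ ((degeneracyMap0 M (M * ℓ) ℓ 2).dualMap z) := by
  classical
  have hℓ : ℓ.Prime := Fact.out
  haveI : NeZero ℓ := ⟨hℓ.ne_zero⟩
  have h1d : M * 1 ∣ M * ℓ := by rw [mul_one]; exact dvd_mul_right M ℓ
  have hℓd : M * ℓ ∣ M * ℓ := dvd_rfl
  have hq₀N : ¬ q₀ ∣ M * ℓ := by
    intro hd
    have h01 : 1 ≡ 0 [MOD q₀] :=
      ((hq₀1.of_dvd hd).symm.trans (Nat.modEq_zero_iff_dvd.mpr (dvd_refl q₀)))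
    exact hq₀.one_lt.ne' (Nat.dvd_one.mp (Nat.modEq_zero_iff_dvd.mp h01))
  by_cases h1 : (1 : HeckeRing0.primeTo M 2 (M * ℓ)) ∈ Ideal.span
      ({(p : HeckeRing0.primeTo M 2 (M * ℓ))} ∪
        {x | ∃ (r : ℕ) (hr : r.Prime) (hrS : ¬ r ∣ M * ℓ),
          x = HeckeRing0.primeTo.T M 2 (M * ℓ) hr hrS - (θ r : HeckeRing0.primeTo M 2 (M * ℓ))})
  · -- CASE 1: `1 ∈ 𝔫₀` ⟹ `Φ = 0` on cycles
    have hzero := apply_eq_zero_of_one_mem_idealSpan_of_dualMap θ (ZMod.natCast_self p) Φ haddΦ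
      hΦT hvan h1
    refine ⟨fun _ ↦ 0, fun _ ↦ 0, fun _ _ _ _ ↦ (add_zero _).symm, fun _ _ _ _ ↦ (add_zero _).symm,
      fun z hz ↦ ?_⟩
    rw [hzero z hz, add_zero]
  · -- CASE 2: the character `χ`
    obtain ⟨χ, hχ⟩ := exists_ringHom_apply_T_eq_of_one_not_mem_idealSpan (p := p) θ h1
    have h𝔫 : (RingHom.ker χ).IsMaximal :=
      RingHom.ker_isMaximal_of_surjective χ (ZMod.ringHom_surjective χ)
    have h2 : (2 : ZMod p) ≠ 0 := by
      rw [show (2 : ZMod p) = ((2 : ℕ) : ZMod p) by norm_cast, Ne, ZMod.natCast_eq_zero_iff]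
      exact fun h ↦ hp2 ((Nat.prime_dvd_prime_iff_eq hp.out Nat.prime_two).mp h)
    have h2' : (2 : HeckeRing0.primeTo M 2 (M * ℓ)) ∉ RingHom.ker χ := by
      rw [RingHom.mem_ker, map_ofNat]; exact h2
    have hE : ¬ HeckeRing0.primeTo.IsEisenstein (RingHom.ker χ) := by
      intro hEis
      have h := hEis q₀ hq₀ hq₀N hq₀1
      rw [RingHom.mem_ker, map_sub, hχ q₀ hq₀ hq₀N, map_add, map_natCast, map_one, sub_eq_zero] at h
      exact hθq₀ h
    have hΦTχ : ∀ (r : ℕ) (hr : r.Prime) (hrS : ¬ r ∣ M * ℓ), ∀ z ∈ periodHomology (M * ℓ),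
        Φ (HeckeRing0.T (M * ℓ) 2 r hr • z) = χ (HeckeRing0.primeTo.T M 2 (M * ℓ) hr hrS) * Φ z :=
      fun r hr hrS z hz ↦ by rw [hχ r hr hrS]; exact hΦT r hr hrS z hz
    obtain ⟨s, hs, hsur⟩ := hI3 (RingHom.ker χ) h𝔫 h2' hE
    have hcs : χ s ≠ 0 := fun h ↦ hs (by rwa [RingHom.mem_ker])
    obtain ⟨t, hαt, hβt, hΦt⟩ := exists_levelRaise Φ χ haddΦ hΦTχ (s : HeckeRing0 M 2) s.2
    choose! zf hzf hzfα hzfβ using hsur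
    -- the kernel condition `T (x, y) = β′_* x − α′_* y = 0`
    let V := Module.Dual ℂ (CuspForm (Gamma0 M) 2)
    let T : V × V →+ Module.Dual ℂ (CuspForm (Gamma0 M') 2) :=
      ((degeneracyMap0 M' M ℓ 2).dualMap.toAddMonoidHom.comp (AddMonoidHom.fst V V)) -
        ((degeneracyMap0 M' M 1 2).dualMap.toAddMonoidHom.comp (AddMonoidHom.snd V V))
    have hT : ∀ v : V × V, T v = 0 ↔
        (degeneracyMap0 M' M ℓ 2).dualMap v.1 = (degeneracyMap0 M' M 1 2).dualMap v.2 := by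
      intro v
      change (degeneracyMap0 M' M ℓ 2).dualMap v.1 - (degeneracyMap0 M' M 1 2).dualMap v.2 = 0 ↔ _
      exact sub_eq_zero
    let L2 : AddSubgroup (V × V) := (periodHomology M).prod (periodHomology M)
    have hL2 : ∀ v : V × V, v ∈ L2 ↔ v.1 ∈ periodHomology M ∧ v.2 ∈ periodHomology M :=
      fun v ↦ AddSubgroup.mem_prod
    -- finiteness of `H₁(X₀(M), ℤ)²`
    haveI : Module.Finite ℤ (periodHomology M) :=
      Module.Finite.iff_addGroup_fg.mpr ((AddGroup.fg_iff_addSubgroup_fg _).mpr periodHomology_fg)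
    haveI : Module.Finite ℤ L2 :=
      Module.Finite.equiv ((AddSubgroup.prodEquiv (periodHomology M) (periodHomology M)).toIntLinearEquiv).symm
    -- `g` on `K ∩ H₁²`: additive by fibre constancy
    let g : V × V → ZMod p := fun v ↦ (χ s)⁻¹ * Φ (zf v.1 v.2)
    have hgadd : ∀ a ∈ L2, ∀ b ∈ L2, T a = 0 → T b = 0 → g (a + b) = g a + g b := by
      intro a ha b hb hTa hTb
      obtain ⟨ha1, ha2⟩ := (hL2 a).mp ha
      obtain ⟨hb1, hb2⟩ := (hL2 b).mp hb
      have hKa := (hT a).mp hTa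
      have hKb := (hT b).mp hTb
      have hKab : (degeneracyMap0 M' M ℓ 2).dualMap (a.1 + b.1) =
          (degeneracyMap0 M' M 1 2).dualMap (a.2 + b.2) := by
        rw [map_add, map_add, hKa, hKb]
      have hsum : zf a.1 a.2 + zf b.1 b.2 ∈ periodHomology (M * ℓ) :=
        add_mem (hzf _ ha1 _ ha2 hKa) (hzf _ hb1 _ hb2 hKb)
      have hfib : Φ (zf (a.1 + b.1) (a.2 + b.2)) = Φ (zf a.1 a.2 + zf b.1 b.2) :=
        apply_eq_of_dualMap_eq Φ haddΦ hvan
          (hzf _ (add_mem ha1 hb1) _ (add_mem ha2 hb2) hKab) hsum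
          (by rw [map_add, hzfα _ (add_mem ha1 hb1) _ (add_mem ha2 hb2) hKab, hzfα _ ha1 _ ha2 hKa,
            hzfα _ hb1 _ hb2 hKb, smul_add])
          (by rw [map_add, hzfβ _ (add_mem ha1 hb1) _ (add_mem ha2 hb2) hKab, hzfβ _ ha1 _ ha2 hKa,
            hzfβ _ hb1 _ hb2 hKb, smul_add])
      change (χ s)⁻¹ * Φ (zf (a.1 + b.1) (a.2 + b.2)) =
        (χ s)⁻¹ * Φ (zf a.1 a.2) + (χ s)⁻¹ * Φ (zf b.1 b.2)
      rw [hfib, haddΦ _ (hzf _ ha1 _ ha2 hKa) _ (hzf _ hb1 _ hb2 hKb), mul_add]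
    -- extend `g` across the three-level cokernel to all of `H₁(X₀(M), ℤ)²`
    obtain ⟨G, hGadd, hGK⟩ := exists_additive_extension_of_ker (K := ℂ) L2 T g hgadd
    have h0M : (0 : V) ∈ periodHomology M := zero_mem _
    refine ⟨fun x ↦ G (x, 0), fun y ↦ G (0, y), fun x hx y hy ↦ ?_, fun x hx y hy ↦ ?_, fun z hz ↦ ?_⟩
    · have e : ((x + y, 0) : V × V) = (x, 0) + (y, 0) := by simp
      beta_reduce
      rw [e, hGadd _ ((hL2 _).mpr ⟨hx, h0M⟩) _ ((hL2 _).mpr ⟨hy, h0M⟩)]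
    · have e : ((0, x + y) : V × V) = (0, x) + (0, y) := by simp
      beta_reduce
      rw [e, hGadd _ ((hL2 _).mpr ⟨h0M, hx⟩) _ ((hL2 _).mpr ⟨h0M, hy⟩)]
    · beta_reduce
      set x := (degeneracyMap0 M (M * ℓ) 1 2).dualMap z with hx
      set y := (degeneracyMap0 M (M * ℓ) ℓ 2).dualMap z with hy
      have hxM : x ∈ periodHomology M := dualMap_degeneracyMap0_mem_periodHomology M (M * ℓ) 1 h1d hz
      have hyM : y ∈ periodHomology M := dualMap_degeneracyMap0_mem_periodHomology M (M * ℓ) ℓ hℓd hz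
      have hK : (degeneracyMap0 M' M ℓ 2).dualMap x = (degeneracyMap0 M' M 1 2).dualMap y :=
        dualMap_degeneracyMap0_comm hM' z
      have hsplit : ((x, y) : V × V) = (x, 0) + (0, y) := by simp
      have hGxy : G (x, y) = G (x, 0) + G (0, y) := by
        rw [hsplit, hGadd _ ((hL2 _).mpr ⟨hxM, h0M⟩) _ ((hL2 _).mpr ⟨h0M, hyM⟩)]
      rw [← hGxy, hGK _ ((hL2 _).mpr ⟨hxM, hyM⟩) ((hT _).mpr hK)]
      -- `g (x, y) = χ(s)⁻¹ Φ(z(x, y)) = χ(s)⁻¹ Φ(t • z) = Φ z`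
      have htz : t • z ∈ periodHomology (M * ℓ) := HeckeRing0.smul_mem_periodHomology _ t hz
      have hw : Φ (zf x y) = Φ (t • z) :=
        apply_eq_of_dualMap_eq Φ haddΦ hvan (hzf x hxM y hyM hK) htz
          (by rw [hzfα x hxM y hyM hK, hαt z]) (by rw [hzfβ x hxM y hyM hK, hβt z])
      change Φ z = (χ s)⁻¹ * Φ (zf x y)
      rw [hw, hΦt z hz, ← mul_assoc, Subtype.coe_eta, inv_mul_cancel₀ hcs, one_mul]

end IharaThree

end Summit.BirchSwinnertonDyer.Rank1Residual.LevelLowering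

end
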